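import Mathlib
import HarnessLib
import Summits.ValiantsHypothesis.ValiantsHypothesis.Theses.MonotoneRestoration
import Literature.Computability.AlgebraicComplexity.ArithCircuit
import Literature.Computability.AlgebraicComplexity.ArithCircuitProofs
import Literature.Computability.AlgebraicComplexity.MonotoneStructure
import Literature.Computability.AlgebraicComplexity.PermanentIrreducible
import Literature.ModelTheory.FiniteModelTheory.CkEquiv
import Summits.ValiantsHypothesis.ValiantsHypothesis.Theorems.MonotoneRestorationMonotoneRestorationQPCosetCount
import Summits.ValiantsHypothesis.ValiantsHypothesis.Theorems.MonotoneRestorationMonotoneRestorationQPSymmetricLB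
import Summits.ValiantsHypothesis.ValiantsHypothesis.Theorems.MonotoneRestorationMonotoneRestorationQPSupportSymmetrisation
import Summits.ValiantsHypothesis.ValiantsHypothesis.Theorems.MonotoneRestorationMonotoneRestorationQPSparseRegime
import Summits.ValiantsHypothesis.ValiantsHypothesis.Theorems.MonotoneRestorationMonotoneRestorationQPBeta
import Literature.Computability.AlgebraicComplexity.SymmetricArithCircuit
import Literature.Computability.AlgebraicComplexity.DawarWilsenach2025Proofs
import Literature.GroupTheory.PermutationGroups.SmallIndexSubgroups
import Summits.ValiantsHypothesis.ValiantsHypothesis.Theorems.MonotoneRestorationQP.Negative.LoadBearing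
import Summits.ValiantsHypothesis.ValiantsHypothesis.Theorems.MonotoneRestorationMonotoneRestorationQPPermSupportCount

/-! TTRL-lite variant V18983 of stmt-ValiantsHypothesis-15886 -/

set_option linter.dupNamespace false

namespace Summit.ValiantsHypothesis.ValiantsHypothesis.Theorems

open Summit.ValiantsHypothesis.ValiantsHypothesis.Theses.MonotoneRestoration
open Literature.Computability.AlgebraicComplexity

/-- TTRL-lite variant V18983 (`small_case`: `f := X i`, a single variable) of
`stub_monotoneComputation_of_complexity` (`stmt-ValiantsHypothesis-15886`): over `ℝ≥0` the gate-free
circuit `ArithCircuit.ofVar i` reading off the variable `i` is a Jerrum–Snir monotone computation of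
`X i` (`isMonotoneComputation_ofVar`) and has size `0` (`ArithCircuit.size_ofVar`), so the target
holds at variables whatever `complexity (X i)` is — the base case of the induction behind the parent
statement. [cite: JerrumSnir1982, §2.2] -/
theorem stub_monotoneComputation_of_complexity_var18983 :
    ∀ (σ : Type) (i : σ), ∃ P : ArithCircuit NNReal σ,
      Literature.Barriers.ValiantsHypothesis.IsMonotoneComputation P (MvPolynomial.X i) ∧ P.size = 0 := by
  intro σ i
  exact ⟨ArithCircuit.ofVar i,
    (Literature.Barriers.ValiantsHypothesis.isMonotoneComputation_ofVar i).1,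
    ArithCircuit.size_ofVar i⟩

end Summit.ValiantsHypothesis.ValiantsHypothesis.Theorems
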